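/-
Copyright: the b2b-balaban T⁴-continuum CRUX team, row NE7b leaf lineage `t4-ne7b-formalise-leaf-02` (gen 135). Project licence.
-/
import Summits.QuantumFields.BalabanUV.T4Continuum.Spine.NE7b.TorusAverageIncidence
import Literature.MathematicalPhysics.QuantumFieldTheory.Balaban1983to89.B7Prop3GeneralRotated

/-!
# THE ONE-STEP BLOCK AVERAGE OF THE TWO-SCALE TORUS AS A FAMILY OF LINEAR LOCAL TERMS: `T_j B = ω·Σ_{(r,t)} R(w_{j,(r,t)}) B(ιA j (r,t))` at the coarse
# bond `j = (y, κ)`, `R_{j,c} := ω·Σ_{(r,t) : ιA j (r,t) = c} R(w_{j,(r,t)})`, `‖R_{j,c}v‖ ≤ (|ω|·n)·‖v‖` for transports in the unit-ball class — the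
# `(inc, R, ℓ = |ω|n)` data of `…AdmissibleFloorSeminormTerms.ims_floor_of_linear_terms` ∕ `…AdmissibleFloorSeminormTwoFamilies` for the AVERAGE TERMS,
# over `…TorusAverageIncidence`'s bonds-of-a-term map (row NE7b, node U5c; residual (R2′) family (2), letter (ℓ1); E-side bookkeeping, CTL's pattern)

Cell `pub-balaban`, sub-cell `t4`, spine estimate NE7b (`T4WeightBudget.RelWeightBound`; the cell's OWN estimate — NOT PRINTED in [Bałaban 1983–89],
NOT PROVED).  Crux-route work under `Spine/NE7b/` by a row leaf (`t4-ne7b-formalise-leaf-02`, E-side ∕ key-readings ∕ lattice-geometry lineage, gen 135)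
under FREEZE (0)'s crux-prover clause; NOTHING of Bałaban's is asserted; no `def` — the incidence `ιA` and the maps `R` are CARRIED BY THEIR CHARACTERISING
HYPOTHESES `hιA` ∕ `hR` (the pattern of `…TorusPlaquetteIncidence` ∕ `…CurlTermsLinear`), `R` inhabited by `exists_avgMaps`; zero `sorry`; no
`T4Continuum/Support` leaf.  Imports: this lineage's `…TorusAverageIncidence` (TAI: `card_fibre_avgBonds_le`) and `Literature.….B7Prop3GeneralRotated`
(`norm_conjR_le`; through it `B7Eq78Linearization.conjR`, `conjR_add`, `conjR_smul_real` and `B7Prop1Explicit.U1` — the rotation `R(w)Z = wZw⁻¹` IS `ℝ`-linear, so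
`LinearMap.mk ⟨conjR w, conjR_add w⟩ (conjR_smul_real w) : 𝔸 →ₗ[ℝ] 𝔸` is written inline, no `def`).

WHY.  The (h2) slot's IMS floor for the FULL form `F(B′) = n^{d−2}·Σ_c|(Q₁B′)(c)|² + Σ_P|(∂B′)(P)|²` (`HOME/b2b-balaban-r1/SectE-interface-proof.md` §5.5) is
`…AdmissibleFloorSeminormTwoFamilies.ims_floor_of_linear_terms_two` (AFS2): two families of linear local terms `T_j x = Σ_{c∈inc j} R_{j,c}(x c)`, each with its
letters `(ℓ, a, b)` and the partition's `(λ, μ)`.  The CURL family's `(inc, R, ℓ = 1)` is `…CurlTermsLinear` (CTL).  THIS FILE is the AVERAGE family's: at `k = 1`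
the covariant one-step average at the coarse bond `c = (y, κ)` of `(ℤ∕M)^d` reads the fine bonds `ιA (y,κ) (r,t) = (n·y + r + t e_κ, κ)` of `(ℤ∕nM)^d`
(TAI), each rotated by a background transport and weighted — [B7] (125): `(Q₀A)_c = Σ_{x∈B(c₋)} L^{−(d+1)} (R_{0,c₋}A)([x, x′])` with
`(R_{0,y}A)(Γ) = Σ_{b⊂Γ} R(V₀(Γ_{y,b₋}))A_b` ([B7] (58); `B7Prop3GeneralRotated.tsum_append_true`, `B7Prop3GeneralLinear.Q0cov`), i.e. the SHAPE
`T_j B = ω·Σ_{(r,t)} R(w_{j,(r,t)}) B(ιA j (r,t))` with a real weight `ω` (print: `L^{−(d+1)}`; `× n^{(d−2)∕2}` when `F^{full}`'s prefactor is taken inside the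
square) and transports `w_{j,(r,t)}` in the unit-ball class `U1` (products of background bond variables, `B7Prop1Explicit.hol_mem`).  WHICH weight, WHICH
transports and WHICH typed operator is print's `Q₁(V)` at `k = 1` (`Q0cov` periodised by `…OneStepAveragePeriodicity`, or `Support/CovariantBlockAveraging.Qcov`)
is the (A3) ∕ OWNER's choice (currency Q-leaf05-g157-1) — here `ω` and `w` are PARAMETERS.  In AFS2's shape the coefficient map of the fine bond `c` in the term `j`
collects the positions `(r,t)` at which `c` occurs (`≤ n` of them, TAI `card_fibre_avgBonds_le`): `R_{j,c} = ω·Σ_{(r,t) : ιA j (r,t) = c} R(w_{j,(r,t)})`, so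
`ℓ_avg = |ω|·n`.

WHAT IS PROVED ([folklore]; `ιA` by `hιA`, `R` by `hR`, `w : J → (Fin d → Fin n) × Fin n → 𝔸ˣ`, `ω : ℝ`):
* §1 `exists_avgMaps` (the family `R` exists); **`norm_avgMap_le`** (`‖R_{j,c}v‖ ≤ (|ω|·n)·‖v‖` for `w ∈ U1`, `0 < n` — AFS2's `hR₂` with `ℓ₂ = |ω|n`).
* §2 **`sum_avgMaps_eq`** — `Σ_{c ∈ image (ιA j)} R_{j,c}(B c) = ω·Σ_{(r,t)} R(w_{j,(r,t)}) B(ιA j (r,t))` (`Finset.sum_fiberwise_of_maps_to`; no injectivity needed).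
* §3 **`norm_sum_avgMaps_eq`** — for an average functional `Y` characterised by `hY : Y j B = ‖ω·Σ_{(r,t)} R(w_{j,(r,t)}) (B (ιA j (r,t)).1 (ιA j (r,t)).2)‖` and the
  bond field read as `x c := B c.1 c.2`: `‖Σ_{c∈image (ιA j)} R_{j,c}(B c.1 c.2)‖ = Y j B`; `sum_sq_norm_avgMaps_eq` (summed over the coarse bonds: AFS2's
  `Σ_j‖T²_j x‖²` IS `Σ_j Y_j(B)²`).
* §4 **`norm_avgTerm_le`** — by value `‖ω·Σ_{(r,t)} R(w_{j,(r,t)}) B(ιA j (r,t))‖ ≤ |ω|·n^{d+1}·a` for `‖B‖ ≤ a` pointwise (the torus twin of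
  `B7Prop3GeneralLinear.norm_Q0cov_le`'s «|(Q₀A)_c| ≤ |A|» at `ω = n^{−(d+1)}`).
* §5 toy: `d = 1`, `n = 2`, `M = 3`, all transports `1` — `hιA` fed by `rfl`, `hR` by `exists_avgMaps` (junction by elaboration, no kernel arithmetic on `ZMod 6`).

NOT HERE (honest): the (A3) choice of `ω`, `w` and of the typed operator `Q₁(V)`; the partition letters (`…SineTentQuadraticPartition` via TAI's `hdisp`,
`D = (d+1)(n−1)`); the two-family floor itself (a later `…SineTentFloorTwoFamilies` ∕ `…FullFormSineFloor`); the local floors `c_loc`; `k > 1`; anything of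
Bałaban's.  BY-NAME EFFECT ON THE WALL: NONE (the average family's `(R, ℓ)` letters of the (h2) slot become a shape and a number; the wall is (R2)).
NE7b NOT PRINTED ∕ NOT PROVED; spine PROVED 0∕9; rung (B)+1 on ONE finite T⁴ — NOT infinite volume, NOT the mass gap, NOT Clay.
HONEST DEPENDENCY: continuum YM on T⁴ ⇐ BetaPertH ∧ nine spine estimates (0/9 proved); BetaPertH ⇐ (D1) ∧ (D4) ∧ CAP+tail; G-an2-4 gates asym, D1 and NE2/3/4.
-/

set_option autoImplicit false

noncomputable section

open Finset
open Literature.MathematicalPhysics.QuantumFieldTheory.Balaban1983to89.B7Prop1Explicit (U1)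
open Literature.MathematicalPhysics.QuantumFieldTheory.Balaban1983to89.B7Eq78Linearization (conjR conjR_add conjR_smul_real)
open Literature.MathematicalPhysics.QuantumFieldTheory.Balaban1983to89.B7Prop3GeneralRotated (norm_conjR_le)
open Summit.QuantumFields.BalabanUV.T4Continuum.NE7b.TorusAverageIncidence (card_fibre_avgBonds_le)

namespace Summit.QuantumFields.BalabanUV.T4Continuum.NE7b.AverageTermsLinear

variable {d M : ℕ} (n : ℕ)
variable {𝔸 : Type*} [NormedRing 𝔸] [NormedAlgebra ℂ 𝔸] [NormOneClass 𝔸] [CompleteSpace 𝔸]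

/-! ## §1 The maps of an average term and their size -/

omit [NormOneClass 𝔸] [CompleteSpace 𝔸] in
/-- THE AVERAGE MAPS EXIST: `R_{j,c} := ω·Σ_{(r,t) : ιA j (r,t) = c} R(w_{j,(r,t)})` (off the term `R_{j,c} = 0`, an empty sum). [folklore] -/
theorem exists_avgMaps
    (ιA : (Fin d → ZMod M) × Fin d → (Fin d → Fin n) × Fin n → (Fin d → ZMod (n * M)) × Fin d)
    (ω : ℝ) (w : (Fin d → ZMod M) × Fin d → (Fin d → Fin n) × Fin n → 𝔸ˣ) :
    ∃ R : (Fin d → ZMod M) × Fin d → (Fin d → ZMod (n * M)) × Fin d → 𝔸 →ₗ[ℝ] 𝔸,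
      ∀ j c, R j c = ω • ∑ rt ∈ Finset.univ.filter (fun rt => ιA j rt = c),
        LinearMap.mk ⟨conjR (w j rt), conjR_add (w j rt)⟩ (conjR_smul_real (w j rt)) :=
  ⟨fun j c => ω • ∑ rt ∈ Finset.univ.filter (fun rt => ιA j rt = c),
      LinearMap.mk ⟨conjR (w j rt), conjR_add (w j rt)⟩ (conjR_smul_real (w j rt)),
    fun _ _ => rfl⟩

omit [CompleteSpace 𝔸] in
/-- **`‖R_{j,c} v‖ ≤ (|ω|·n)·‖v‖`** for transports in the unit-ball class (`‖R(w)Z‖ ≤ ‖Z‖`, `norm_conjR_le`) — a fine bond occurs at most `n` times in one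
term (TAI `card_fibre_avgBonds_le`): AFS2's `hR₂` with `ℓ₂ = |ω|·n`. [folklore] -/
theorem norm_avgMap_le [NeZero M] (hn : 0 < n)
    (ιA : (Fin d → ZMod M) × Fin d → (Fin d → Fin n) × Fin n → (Fin d → ZMod (n * M)) × Fin d)
    (hιA : ∀ y κ r t, ιA (y, κ) (r, t) =
      ((fun i => (((y i).val * n + (r i : ℕ) : ℕ) : ZMod (n * M))) + Pi.single κ ((t : ℕ) : ZMod (n * M)), κ))
    (ω : ℝ) (w : (Fin d → ZMod M) × Fin d → (Fin d → Fin n) × Fin n → 𝔸ˣ) (hw : ∀ j rt, w j rt ∈ U1 𝔸)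
    (R : (Fin d → ZMod M) × Fin d → (Fin d → ZMod (n * M)) × Fin d → 𝔸 →ₗ[ℝ] 𝔸)
    (hR : ∀ j c, R j c = ω • ∑ rt ∈ Finset.univ.filter (fun rt => ιA j rt = c),
        LinearMap.mk ⟨conjR (w j rt), conjR_add (w j rt)⟩ (conjR_smul_real (w j rt)))
    (j : (Fin d → ZMod M) × Fin d) (c : (Fin d → ZMod (n * M)) × Fin d) (v : 𝔸) :
    ‖R j c v‖ ≤ (|ω| * n) * ‖v‖ := by
  classical
  rw [hR, LinearMap.smul_apply, LinearMap.sum_apply, norm_smul, Real.norm_eq_abs, mul_assoc]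
  refine mul_le_mul_of_nonneg_left ?_ (abs_nonneg ω)
  calc ‖∑ rt ∈ Finset.univ.filter (fun rt => ιA j rt = c),
          (LinearMap.mk ⟨conjR (w j rt), conjR_add (w j rt)⟩ (conjR_smul_real (w j rt)) : 𝔸 →ₗ[ℝ] 𝔸) v‖
      ≤ ∑ rt ∈ Finset.univ.filter (fun rt => ιA j rt = c), ‖v‖ :=
        norm_sum_le_of_le _ fun rt _ => norm_conjR_le (hw j rt) v
    _ = ((Finset.univ.filter (fun rt => ιA j rt = c)).card : ℝ) * ‖v‖ := by rw [sum_const, nsmul_eq_mul]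
    _ ≤ n * ‖v‖ := by
        refine mul_le_mul_of_nonneg_right ?_ (norm_nonneg v)
        exact_mod_cast card_fibre_avgBonds_le n ιA hιA hn j c

/-! ## §2 The sum over the bonds of a term is the weighted rotated average -/

omit [NormOneClass 𝔸] [CompleteSpace 𝔸] in
/-- **`Σ_{c ∈ image (ιA j)} R_{j,c}(B c) = ω·Σ_{(r,t)} R(w_{j,(r,t)}) B(ιA j (r,t))`** — regrouping the positions of the term by the bond they read
(`Finset.sum_fiberwise_of_maps_to`; repeated bonds are summed with multiplicity, as print's (125) does). [folklore] -/
theorem sum_avgMaps_eq [DecidableEq (Fin d → ZMod (n * M))]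
    (ιA : (Fin d → ZMod M) × Fin d → (Fin d → Fin n) × Fin n → (Fin d → ZMod (n * M)) × Fin d)
    (ω : ℝ) (w : (Fin d → ZMod M) × Fin d → (Fin d → Fin n) × Fin n → 𝔸ˣ)
    (R : (Fin d → ZMod M) × Fin d → (Fin d → ZMod (n * M)) × Fin d → 𝔸 →ₗ[ℝ] 𝔸)
    (hR : ∀ j c, R j c = ω • ∑ rt ∈ Finset.univ.filter (fun rt => ιA j rt = c),
        LinearMap.mk ⟨conjR (w j rt), conjR_add (w j rt)⟩ (conjR_smul_real (w j rt)))
    (j : (Fin d → ZMod M) × Fin d) (B : (Fin d → ZMod (n * M)) × Fin d → 𝔸) :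
    ∑ c ∈ Finset.univ.image (ιA j), R j c (B c) = ω • ∑ rt, conjR (w j rt) (B (ιA j rt)) := by
  classical
  have hfib : ∀ c, R j c (B c) = ω • ∑ rt ∈ Finset.univ.filter (fun rt => ιA j rt = c), conjR (w j rt) (B (ιA j rt)) := by
    intro c
    rw [hR, LinearMap.smul_apply, LinearMap.sum_apply]
    congr 1
    refine Finset.sum_congr rfl fun rt hrt => ?_
    rw [(Finset.mem_filter.1 hrt).2]
    rfl
  simp_rw [hfib]
  rw [← Finset.smul_sum, Finset.sum_fiberwise_of_maps_to (fun rt _ => Finset.mem_image_of_mem (ιA j) (Finset.mem_univ rt))]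

/-! ## §3 … so `‖T_j B‖` is the average functional -/

omit [NormOneClass 𝔸] [CompleteSpace 𝔸] in
/-- **AFS2's `‖T²_j x‖` IS THE AVERAGE FUNCTIONAL**: for `Y` characterised by `hY` and the bond field read as `x c := B c.1 c.2`:
`‖Σ_{c∈image (ιA j)} R_{j,c}(B c.1 c.2)‖ = Y j B`. [folklore] -/
theorem norm_sum_avgMaps_eq [DecidableEq (Fin d → ZMod (n * M))]
    (ιA : (Fin d → ZMod M) × Fin d → (Fin d → Fin n) × Fin n → (Fin d → ZMod (n * M)) × Fin d)
    (ω : ℝ) (w : (Fin d → ZMod M) × Fin d → (Fin d → Fin n) × Fin n → 𝔸ˣ)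
    (R : (Fin d → ZMod M) × Fin d → (Fin d → ZMod (n * M)) × Fin d → 𝔸 →ₗ[ℝ] 𝔸)
    (hR : ∀ j c, R j c = ω • ∑ rt ∈ Finset.univ.filter (fun rt => ιA j rt = c),
        LinearMap.mk ⟨conjR (w j rt), conjR_add (w j rt)⟩ (conjR_smul_real (w j rt)))
    (Y : (Fin d → ZMod M) × Fin d → ((Fin d → ZMod (n * M)) → Fin d → 𝔸) → ℝ)
    (hY : ∀ j B, Y j B = ‖ω • ∑ rt, conjR (w j rt) (B (ιA j rt).1 (ιA j rt).2)‖)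
    (j : (Fin d → ZMod M) × Fin d) (B : (Fin d → ZMod (n * M)) → Fin d → 𝔸) :
    ‖∑ c ∈ Finset.univ.image (ιA j), R j c (B c.1 c.2)‖ = Y j B := by
  rw [sum_avgMaps_eq n ιA ω w R hR j (fun c => B c.1 c.2), hY]

omit [NormOneClass 𝔸] [CompleteSpace 𝔸] in
/-- … summed over the coarse bonds: `Σ_j ‖T²_j x‖² = Σ_j Y_j(B)²` — AFS2's `hF` ∕ `hloc` second summands ARE the average part of the full form. [folklore] -/
theorem sum_sq_norm_avgMaps_eq [NeZero M] [DecidableEq (Fin d → ZMod (n * M))]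
    (ιA : (Fin d → ZMod M) × Fin d → (Fin d → Fin n) × Fin n → (Fin d → ZMod (n * M)) × Fin d)
    (ω : ℝ) (w : (Fin d → ZMod M) × Fin d → (Fin d → Fin n) × Fin n → 𝔸ˣ)
    (R : (Fin d → ZMod M) × Fin d → (Fin d → ZMod (n * M)) × Fin d → 𝔸 →ₗ[ℝ] 𝔸)
    (hR : ∀ j c, R j c = ω • ∑ rt ∈ Finset.univ.filter (fun rt => ιA j rt = c),
        LinearMap.mk ⟨conjR (w j rt), conjR_add (w j rt)⟩ (conjR_smul_real (w j rt)))
    (Y : (Fin d → ZMod M) × Fin d → ((Fin d → ZMod (n * M)) → Fin d → 𝔸) → ℝ)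
    (hY : ∀ j B, Y j B = ‖ω • ∑ rt, conjR (w j rt) (B (ιA j rt).1 (ιA j rt).2)‖)
    (B : (Fin d → ZMod (n * M)) → Fin d → 𝔸) :
    ∑ j, ‖∑ c ∈ Finset.univ.image (ιA j), R j c (B c.1 c.2)‖ ^ 2 = ∑ j, Y j B ^ 2 :=
  Finset.sum_congr rfl fun j _ => by rw [norm_sum_avgMaps_eq n ιA ω w R hR Y hY j B]

/-! ## §4 By value: `‖T_j B‖ ≤ |ω|·n^{d+1}·sup‖B‖` -/

omit [CompleteSpace 𝔸] in
/-- **THE SIZE OF ONE AVERAGE TERM**: `‖ω·Σ_{(r,t)} R(w_{j,(r,t)}) B(ιA j (r,t))‖ ≤ |ω|·n^{d+1}·a` when `‖B c‖ ≤ a` for every bond — the `n^d` block sites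
times the `n` positions, each a rotated bond variable of norm `≤ a` (print's «|(Q₀A)_c| ≤ |A|» after (125) at `ω = n^{−(d+1)}`; the torus twin of
`B7Prop3GeneralLinear.norm_Q0cov_le`). [folklore] -/
theorem norm_avgTerm_le
    (ιA : (Fin d → ZMod M) × Fin d → (Fin d → Fin n) × Fin n → (Fin d → ZMod (n * M)) × Fin d)
    (ω : ℝ) (w : (Fin d → ZMod M) × Fin d → (Fin d → Fin n) × Fin n → 𝔸ˣ) (hw : ∀ j rt, w j rt ∈ U1 𝔸)
    (B : (Fin d → ZMod (n * M)) × Fin d → 𝔸) {a : ℝ} (hB : ∀ c, ‖B c‖ ≤ a) (j : (Fin d → ZMod M) × Fin d) :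
    ‖ω • ∑ rt, conjR (w j rt) (B (ιA j rt))‖ ≤ |ω| * n ^ (d + 1) * a := by
  rw [norm_smul, Real.norm_eq_abs, mul_assoc]
  refine mul_le_mul_of_nonneg_left ?_ (abs_nonneg ω)
  calc ‖∑ rt, conjR (w j rt) (B (ιA j rt))‖ ≤ ∑ _rt : (Fin d → Fin n) × Fin n, a :=
        norm_sum_le_of_le _ fun rt _ => (norm_conjR_le (hw j rt) _).trans (hB _)
    _ = n ^ (d + 1) * a := by
        rw [sum_const, card_univ, Fintype.card_prod, Fintype.card_fun, Fintype.card_fin, Fintype.card_fin, nsmul_eq_mul]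
        push_cast
        ring

/-! ## §5 Toy: `d = 1`, `n = 2`, `M = 3`, all transports `1` — the hypotheses are inhabited (elaboration only) -/

/-- Toy: on the `6`-cycle the maps of `exists_avgMaps` for the incidence given by TAI's defining lambda (`hιA` fed by `rfl`) and trivial transports
obey `‖R_{j,c}v‖ ≤ (|¼|·2)·‖v‖` — junction by elaboration (instantiation only; no kernel arithmetic on `ZMod 6`). -/
example (v : 𝔸) (j : (Fin 1 → ZMod 3) × Fin 1) (c : (Fin 1 → ZMod (2 * 3)) × Fin 1) : True := by
  haveI : NeZero (3 : ℕ) := ⟨by norm_num⟩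
  obtain ⟨R, hR⟩ := exists_avgMaps (𝔸 := 𝔸) 2
    (fun (j : (Fin 1 → ZMod 3) × Fin 1) (rt : (Fin 1 → Fin 2) × Fin 2) =>
      ((fun i => (((j.1 i).val * 2 + (rt.1 i : ℕ) : ℕ) : ZMod (2 * 3))) + Pi.single j.2 ((rt.2 : ℕ) : ZMod (2 * 3)), j.2))
    (1 / 4 : ℝ) (fun _ _ => 1)
  have := norm_avgMap_le 2 (by norm_num) _ (fun _ _ _ _ => rfl) (1 / 4 : ℝ) (fun _ _ => 1) (fun _ _ => Subgroup.one_mem _) R hR j c v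
  trivial

end Summit.QuantumFields.BalabanUV.T4Continuum.NE7b.AverageTermsLinear

end
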